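import Summits.AtomisticToContinuum.HydrodynamicLimit.Theses.OneFlightGossipEngine
import Summits.AtomisticToContinuum.HydrodynamicLimit.Theses.TwoClocks
import Summits.AtomisticToContinuum.HydrodynamicLimit.Theorems.OneFlightGossipEngineUniformLocalGibbsConcentrationFields

/-!
# `UniformLocalGibbsConcentration` PROVED (routes `OneFlightGossipEngine`, `TwoClocks`) — η₀-uniform exponential LLN for local Gibbs states

Support item stmt-AtomisticToContinuum-14445 (routes `TwoClocks`, `OneFlightGossipEngine` of
`AtomisticToContinuum/HydrodynamicLimit`): there is a universal `η₀ > 0` such that for all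
continuous profiles `a, θ₀ > 0`, `u₀` and every `σ > 0` with `σ³ · sup a ≤ η₀ ∫ a`, the canonical
local Gibbs laws `localGibbsLaw σ a u₀ θ₀ N Φ` of `N + 1` hard spheres of diameter `σ(N+1)^{-1/3}` on
`𝕋³` are probability measures and their empirical density / momentum / energy fields, tested
against any continuous `χ`, concentrate EXPONENTIALLY (`≤ C e^{-(N+1)/C}` for all `N`, all flows)
around `∫χρ₀`, `∫χρ₀u₀`, `∫χE(ρ₀,u₀,θ₀)` for the continuous positive density
`ρ₀ = rhoLim (profileOf a) σ` of the tree's cluster expansion (`HardSphereEulerLLN`).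

Witness `η₀ = min (1/(64 e v₁)) (1/16)` (`v₁` = volume of the unit ball of `ℝ³`). Assembly of
* `UniformLGC.density_concentration` (`…Density`): large-deviation upper bound for the density field
  of the canonical gas by the exponential Chebyshev inequality with the TILTED profile
  (`…Tilt`), the tree's one-point cluster limit for the tilted profile, and the profile-Lipschitz
  bound of the limit functional (`…Perturb`);
* `UniformLGC.localGibbsMeasure_velFluct_exp_le` (`…Velocity`): Chernoff bound for the Maxwellian
  velocity fluctuations given the positions (Fernique exponential moments);
* the bookkeeping of `…Fields` (momentum coordinatewise, energy = fluctuation + weighted density).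
Sources: Ruelle 1969 §4 / Lebowitz–Penrose 1964 (low-density expansions), Pulvirenti–Tsagkarogiannis
2012 (canonical cluster expansion), Kipnis–Landim 1999 App. 2 (exponential Chebyshev / LD upper
bounds), Spohn 1991 Part I §2.3 (local equilibrium).
-/

noncomputable section

namespace Summit.AtomisticToContinuum.HydrodynamicLimit.Theorems

open MeasureTheory ProbabilityTheory Filter Set Topology Finset
open scoped ENNReal
open Literature.MathematicalPhysics.KineticTheory Literature.MathematicalPhysics.StatisticalMechanics

namespace UniformLGC

section FieldBounds

variable {a₀ θ₀ : T3 → ℝ} {u₀ : T3 → V3} {σ : ℝ}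

/-- **Momentum field.** Under the uniform smallness, for continuous `χ` and `δ > 0`:
`localGibbsMeasure {δ < ‖(N+1)⁻¹ ∑ χ(xᵢ) vᵢ - ∫ χ ρ₀ u₀‖} ≤ K e^{-(N+1)/K}` for all `N`
(coordinatewise: Maxwellian fluctuation + density field with weight `χ u₀ₗ`). -/
theorem localGibbsMeasure_momentum_le (ha : Continuous a₀) (hθ : Continuous θ₀) (hu : Continuous u₀)
    (ha0 : ∀ x, 0 < a₀ x) (hθ0 : ∀ x, 0 < θ₀ x) (hσ : 0 < σ) (hσ2 : σ < 1 / 2)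
    (hsmall : Real.exp 1 * (2 * (profileOf a₀ ha ha0).M * v₁ * σ ^ 3) ≤ 1 / 32)
    {χ : T3 → ℝ} (hχ : Continuous χ) {δ : ℝ} (hδ : 0 < δ) :
    ∃ K : ℝ, 0 < K ∧ ∀ N : ℕ, localGibbsMeasure σ a₀ u₀ θ₀ N
        {w | δ < ‖empiricalMomentumField w χ -
          ∫ x, (χ x * rhoLim (profileOf a₀ ha ha0) σ x) • u₀ x‖} ≤
      ENNReal.ofReal (K * Real.exp (-(K⁻¹ * ((N : ℝ) + 1)))) := by
  set P := profileOf a₀ ha ha0 with hP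
  set ρ₀ := rhoLim P σ with hρ₀
  have hPs : SmallDensity P σ :=
    smallDensity_of_eta_le (Mstar := 2 * P.M) hσ hσ2 (by linarith [P.M_pos]) hsmall
  have hρc : Continuous ρ₀ := hPs.continuous_rhoLim
  set I : V3 := ∫ x, (χ x * ρ₀ x) • u₀ x with hI
  have hIl : ∀ l : Fin 3, I l = ∫ x, χ x * u₀ x l * ρ₀ x := by
    intro l
    have hint : Integrable (fun x => (χ x * ρ₀ x) • u₀ x) :=
      integrable_of_continuous_T3 ((hχ.mul hρc).smul hu)
    rw [hI, show (∫ x, (χ x * ρ₀ x) • u₀ x) l =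
        (EuclideanSpace.proj l : V3 →L[ℝ] ℝ) (∫ x, (χ x * ρ₀ x) • u₀ x) from rfl,
      ← ContinuousLinearMap.integral_comp_comm _ hint]
    refine integral_congr_ae (Eventually.of_forall fun x => ?_)
    simp only [EuclideanSpace.coe_proj, PiLp.smul_apply, smul_eq_mul]
    ring
  have hcoord : ∀ l : Fin 3, ∃ K : ℝ, 0 < K ∧ ∀ N : ℕ, localGibbsMeasure σ a₀ u₀ θ₀ N
      {w | δ / 3 < |(empiricalMomentumField w χ - I) l|} ≤
        ENNReal.ofReal (K * Real.exp (-(K⁻¹ * ((N : ℝ) + 1)))) := by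
    intro l
    obtain ⟨KA, hKA, hA⟩ := localGibbsMeasure_velFluct_Kexp ha hθ hu ha0 hθ0 hσ2.le
      (Y := fun x v => v l - u₀ x l) (by fun_prop)
      (fun x => by
        rw [integral_sub ((memLp_coord_gaussMeasure (u₀ x) (θ₀ x) l 2 (by simp)).integrable
          one_le_two) (integrable_const _), integral_coord_gaussMeasure _ (hθ0 x), integral_const]
        simp)
      (expMoment_coord hθ hu l) hχ (δ := δ / 6) (by positivity)
    obtain ⟨KB, hKB, hB⟩ := localGibbsMeasure_density_le (u₀ := u₀) ha hθ hu ha0 hθ0 hσ hσ2 hsmall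
      (g := fun y => χ y * u₀ y l) (hχ.mul (by fun_prop)) (δ := δ / 6) (by positivity)
    refine ⟨KA + KB, by positivity, fun N => ?_⟩
    have hn : (0 : ℝ) ≤ (N : ℝ) + 1 := by positivity
    calc localGibbsMeasure σ a₀ u₀ θ₀ N {w | δ / 3 < |(empiricalMomentumField w χ - I) l|}
        = localGibbsMeasure σ a₀ u₀ θ₀ N {w | 2 * (δ / 6) <
            |((N + 1 : ℕ) : ℝ)⁻¹ * ∑ i, χ (w i).1 * ((w i).2 l - u₀ (w i).1 l) +
              (((N + 1 : ℕ) : ℝ)⁻¹ * ∑ i, χ (w i).1 * u₀ (w i).1 l - ∫ y, χ y * u₀ y l * ρ₀ y)|} := by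
          congr 1
          ext w
          simp only [Set.mem_setOf_eq]
          rw [PiLp.sub_apply, empiricalMomentumField_apply_sub w χ u₀ l (I l), hIl,
            show (2 : ℝ) * (δ / 6) = δ / 3 by ring]
      _ ≤ _ := measure_lt_abs_add_le _ _ _ _
      _ ≤ ENNReal.ofReal (KA * Real.exp (-(KA⁻¹ * ((N : ℝ) + 1)))) +
            ENNReal.ofReal (KB * Real.exp (-(KB⁻¹ * ((N : ℝ) + 1)))) := add_le_add (hA N) (hB N)
      _ ≤ _ := ofReal_Kexp_add_le hKA hKB hn
  choose Kl hKl0 hKl using hcoord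
  set Kt := ∑ l, Kl l with hKt
  have hKt0 : 0 < Kt := sum_pos (fun l _ => hKl0 l) univ_nonempty
  have hKle : ∀ l, Kl l ≤ Kt := fun l => single_le_sum (fun l _ => (hKl0 l).le) (mem_univ l)
  refine ⟨3 * Kt, by positivity, fun N => ?_⟩
  have hn : (0 : ℝ) ≤ (N : ℝ) + 1 := by positivity
  calc localGibbsMeasure σ a₀ u₀ θ₀ N {w | δ < ‖empiricalMomentumField w χ - I‖}
      ≤ ∑ l, localGibbsMeasure σ a₀ u₀ θ₀ N {w | δ / 3 < |(empiricalMomentumField w χ - I) l|} :=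
        measure_setOf_lt_norm_le _ (fun w => empiricalMomentumField w χ - I) hδ.le
    _ ≤ ∑ _l : Fin 3, ENNReal.ofReal (Kt * Real.exp (-(Kt⁻¹ * ((N : ℝ) + 1)))) :=
        sum_le_sum fun l _ => (hKl l N).trans (ENNReal.ofReal_le_ofReal (Kexp_le_Kexp (hKl0 l) (hKle l) hn))
    _ = ENNReal.ofReal (3 * (Kt * Real.exp (-(Kt⁻¹ * ((N : ℝ) + 1))))) := by
        rw [sum_const, card_univ, Fintype.card_fin, nsmul_eq_mul, Nat.cast_ofNat,
          ENNReal.ofReal_mul (by norm_num : (0 : ℝ) ≤ 3), ENNReal.ofReal_ofNat]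
    _ ≤ ENNReal.ofReal ((3 * Kt) * Real.exp (-((3 * Kt)⁻¹ * ((N : ℝ) + 1)))) := by
        refine ENNReal.ofReal_le_ofReal ?_
        have h1 := exp_negInv_le hKt0 (by linarith : Kt ≤ 3 * Kt) hn
        have h2 : 0 < Real.exp (-(Kt⁻¹ * ((N : ℝ) + 1))) := Real.exp_pos _
        nlinarith

/-- **Energy field.** Under the uniform smallness, for continuous `χ` and `δ > 0`:
`localGibbsMeasure {δ < |(N+1)⁻¹ ∑ χ(xᵢ)|vᵢ|²/2 - ∫ χ E(ρ₀,u₀,θ₀)|} ≤ K e^{-(N+1)/K}` for all `N`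
(kinetic-energy fluctuation + density field with weight `χ(|u₀|²/2 + 3θ₀/2)`). -/
theorem localGibbsMeasure_energy_le (ha : Continuous a₀) (hθ : Continuous θ₀) (hu : Continuous u₀)
    (ha0 : ∀ x, 0 < a₀ x) (hθ0 : ∀ x, 0 < θ₀ x) (hσ : 0 < σ) (hσ2 : σ < 1 / 2)
    (hsmall : Real.exp 1 * (2 * (profileOf a₀ ha ha0).M * v₁ * σ ^ 3) ≤ 1 / 32)
    {χ : T3 → ℝ} (hχ : Continuous χ) {δ : ℝ} (hδ : 0 < δ) :
    ∃ K : ℝ, 0 < K ∧ ∀ N : ℕ, localGibbsMeasure σ a₀ u₀ θ₀ N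
        {w | δ < |empiricalEnergyField w χ -
          ∫ x, χ x * totalEnergyDensity (rhoLim (profileOf a₀ ha ha0) σ x) (u₀ x) (θ₀ x)|} ≤
      ENNReal.ofReal (K * Real.exp (-(K⁻¹ * ((N : ℝ) + 1)))) := by
  set P := profileOf a₀ ha ha0 with hP
  set ρ₀ := rhoLim P σ with hρ₀
  have hI : ∫ x, χ x * totalEnergyDensity (ρ₀ x) (u₀ x) (θ₀ x) =
      ∫ x, χ x * (‖u₀ x‖ ^ 2 / 2 + Fintype.card (Fin 3) * θ₀ x / 2) * ρ₀ x := by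
    refine integral_congr_ae (Eventually.of_forall fun x => ?_)
    simp only [totalEnergyDensity, Fintype.card_fin, Nat.cast_ofNat]
    ring
  obtain ⟨KA, hKA, hA⟩ := localGibbsMeasure_velFluct_Kexp ha hθ hu ha0 hθ0 hσ2.le
    (Y := fun x v => ‖v‖ ^ 2 / 2 - ‖u₀ x‖ ^ 2 / 2 - Fintype.card (Fin 3) * θ₀ x / 2) (by fun_prop)
    (fun x => integral_energy_gaussMeasure (u₀ x) (hθ0 x)) (expMoment_energy hθ hu hθ0) hχ
    (δ := δ / 2) (by positivity)
  obtain ⟨KB, hKB, hB⟩ := localGibbsMeasure_density_le (u₀ := u₀) ha hθ hu ha0 hθ0 hσ hσ2 hsmall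
    (g := fun y => χ y * (‖u₀ y‖ ^ 2 / 2 + Fintype.card (Fin 3) * θ₀ y / 2)) (by fun_prop)
    (δ := δ / 2) (by positivity)
  refine ⟨KA + KB, by positivity, fun N => ?_⟩
  have hn : (0 : ℝ) ≤ (N : ℝ) + 1 := by positivity
  calc localGibbsMeasure σ a₀ u₀ θ₀ N {w | δ < |empiricalEnergyField w χ -
          ∫ x, χ x * totalEnergyDensity (ρ₀ x) (u₀ x) (θ₀ x)|}
      = localGibbsMeasure σ a₀ u₀ θ₀ N {w | 2 * (δ / 2) <
          |((N + 1 : ℕ) : ℝ)⁻¹ * ∑ i, χ (w i).1 * (‖(w i).2‖ ^ 2 / 2 - ‖u₀ (w i).1‖ ^ 2 / 2 -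
              Fintype.card (Fin 3) * θ₀ (w i).1 / 2) +
            (((N + 1 : ℕ) : ℝ)⁻¹ * ∑ i, χ (w i).1 * (‖u₀ (w i).1‖ ^ 2 / 2 +
              Fintype.card (Fin 3) * θ₀ (w i).1 / 2) -
              ∫ y, χ y * (‖u₀ y‖ ^ 2 / 2 + Fintype.card (Fin 3) * θ₀ y / 2) * ρ₀ y)|} := by
        congr 1
        ext w
        simp only [Set.mem_setOf_eq]
        rw [empiricalEnergyField_sub w χ u₀ θ₀ _, hI, show (2 : ℝ) * (δ / 2) = δ by ring]
    _ ≤ _ := measure_lt_abs_add_le _ _ _ _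
    _ ≤ ENNReal.ofReal (KA * Real.exp (-(KA⁻¹ * ((N : ℝ) + 1)))) +
          ENNReal.ofReal (KB * Real.exp (-(KB⁻¹ * ((N : ℝ) + 1)))) := add_le_add (hA N) (hB N)
    _ ≤ _ := ofReal_Kexp_add_le hKA hKB hn

end FieldBounds

end UniformLGC

open UniformLGC

/-- **The η₀-uniform exponential law of large numbers for canonical local Gibbs states of hard
spheres** (`OneFlightGossipEngine.UniformLocalGibbsConcentration` = `TwoClocks.UniformLocalGibbsConcentration`, stmt-AtomisticToContinuum-14445). With
`η₀ = min (1/(64 e v₁)) (1/16)`: for continuous `a, θ₀ > 0`, `u₀` and `σ > 0` with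
`σ³ · sup a ≤ η₀ ∫ a`, the laws `localGibbsLaw σ a u₀ θ₀ N Φ` are probability measures for all
`N, Φ` and, with `ρ₀ = rhoLim (profileOf a) σ > 0` continuous, the empirical density / momentum /
energy fields tested against any continuous `χ` deviate from `∫χρ₀`, `∫(χρ₀)u₀`, `∫χE(ρ₀,u₀,θ₀)` by
more than `δ` with probability `≤ C e^{-(N+1)/C}`, for all `N` and all flows (static: the laws do
not depend on the flow). Low-density cluster expansion (tree) + exponential Chebyshev with tilted
profiles + Chernoff for the Maxwellian velocities. -/
theorem uniformLocalGibbsConcentration_proof :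
    Summit.AtomisticToContinuum.HydrodynamicLimit.Theses.OneFlightGossipEngine.UniformLocalGibbsConcentration := by
  unfold Summit.AtomisticToContinuum.HydrodynamicLimit.Theses.OneFlightGossipEngine.UniformLocalGibbsConcentration
  have he0 : 0 < Real.exp 1 := Real.exp_pos 1
  have hv : 0 < v₁ := v₁_pos
  refine ⟨min (1 / (64 * Real.exp 1 * v₁)) (1 / 16), lt_min (by positivity) (by norm_num), ?_⟩
  intro a θ₀ u₀ ha hθ hu ha0 hθ0 σ hσ hguard
  set η₀ := min (1 / (64 * Real.exp 1 * v₁)) (1 / 16) with hη₀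
  have hη₀1 : η₀ ≤ 1 / (64 * Real.exp 1 * v₁) := min_le_left _ _
  have hη₀2 : η₀ ≤ 1 / 16 := min_le_right _ _
  have hη₀0 : 0 < η₀ := lt_min (by positivity) (by norm_num)
  set P := profileOf a ha ha0 with hP
  -- the supremum and the integral of the activity
  have hbdd : BddAbove (Set.range a) := (isCompact_range ha).bddAbove
  have hsup_ge : ∀ x, a x ≤ ⨆ y, a y := fun x => le_ciSup hbdd x
  have hsup_pos : 0 < ⨆ y, a y := (ha0 0).trans_le (hsup_ge 0)
  have hint_pos : 0 < ∫ y, a y := integral_pos_of_continuous_pos ha ha0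
  have hint_le : ∫ y, a y ≤ ⨆ y, a y :=
    (integral_mono (integrable_of_continuous_T3 ha) (integrable_const _) hsup_ge).trans (by simp)
  -- `σ³ ≤ η₀ ≤ 1/16`, so `σ < 1/2`
  have hσ3 : σ ^ 3 ≤ η₀ := by
    have h1 : σ ^ 3 * (⨆ y, a y) ≤ η₀ * (⨆ y, a y) :=
      hguard.trans (mul_le_mul_of_nonneg_left hint_le hη₀0.le)
    exact le_of_mul_le_mul_right h1 hsup_pos
  have hσ2 : σ < 1 / 2 := by
    by_contra hc
    push Not at hc
    have : (1 / 2 : ℝ) ^ 3 ≤ σ ^ 3 := pow_le_pow_left₀ (by norm_num) hc 3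
    linarith
  -- the uniform smallness of the profile `β = a/∫a`
  have hPM : P.M ≤ (⨆ y, a y) / ∫ y, a y := by
    refine csSup_le (Set.range_nonempty _) ?_
    rintro _ ⟨x, rfl⟩
    rw [hP, profileOf_β]
    exact div_le_div_of_nonneg_right (hsup_ge x) hint_pos.le
  have hsmall : Real.exp 1 * (2 * P.M * v₁ * σ ^ 3) ≤ 1 / 32 := by
    have h1 : P.M * σ ^ 3 ≤ η₀ := by
      calc P.M * σ ^ 3 ≤ (⨆ y, a y) / (∫ y, a y) * σ ^ 3 :=
            mul_le_mul_of_nonneg_right hPM (pow_pos hσ 3).le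
        _ = σ ^ 3 * (⨆ y, a y) / ∫ y, a y := by ring
        _ ≤ η₀ * (∫ y, a y) / ∫ y, a y := div_le_div_of_nonneg_right hguard hint_pos.le
        _ = η₀ := by field_simp
    have h2 : Real.exp 1 * v₁ * η₀ ≤ 1 / 64 := by
      calc Real.exp 1 * v₁ * η₀ ≤ Real.exp 1 * v₁ * (1 / (64 * Real.exp 1 * v₁)) :=
            mul_le_mul_of_nonneg_left hη₀1 (by positivity)
        _ = 1 / 64 := by field_simp
    calc Real.exp 1 * (2 * P.M * v₁ * σ ^ 3) = 2 * (Real.exp 1 * v₁) * (P.M * σ ^ 3) := by ring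
      _ ≤ 2 * (Real.exp 1 * v₁) * η₀ := mul_le_mul_of_nonneg_left h1 (by positivity)
      _ = 2 * (Real.exp 1 * v₁ * η₀) := by ring
      _ ≤ 1 / 32 := by linarith
  have hPs : SmallDensity P σ :=
    smallDensity_of_eta_le (Mstar := 2 * P.M) hσ hσ2 (by linarith [P.M_pos]) hsmall
  have hθP : geomRatio P σ ≤ 1 / 16 := by
    rw [geomRatio, ovDensity]
    calc 2 * Real.exp 1 * (P.M * v₁ * σ ^ 3) = Real.exp 1 * (2 * P.M * v₁ * σ ^ 3) := by ring
      _ ≤ 1 / 16 := hsmall.trans (by norm_num)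
  refine ⟨rhoLim P σ, hPs.continuous_rhoLim, fun x => rhoLim_pos_of_geomRatio_le hPs hθP x,
    fun N Φ => isProbabilityMeasure_localGibbsLaw ha hθ hu ha0 hθ0 hσ2.le N Φ, ?_⟩
  intro χ hχ δ hδ
  obtain ⟨K₁, hK₁, h₁⟩ := localGibbsMeasure_density_le (u₀ := u₀) ha hθ hu ha0 hθ0 hσ hσ2 hsmall hχ hδ
  obtain ⟨K₂, hK₂, h₂⟩ := localGibbsMeasure_momentum_le ha hθ hu ha0 hθ0 hσ hσ2 hsmall hχ hδ
  obtain ⟨K₃, hK₃, h₃⟩ := localGibbsMeasure_energy_le ha hθ hu ha0 hθ0 hσ hσ2 hsmall hχ hδ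
  refine ⟨K₁ + K₂ + K₃, by positivity, fun N Φ => ?_⟩
  have hn : (0 : ℝ) ≤ (N : ℝ) + 1 := by positivity
  have hK12 : K₁ ≤ K₁ + K₂ + K₃ := by linarith
  have hK22 : K₂ ≤ K₁ + K₂ + K₃ := by linarith
  have hK32 : K₃ ≤ K₁ + K₂ + K₃ := by linarith
  rw [localGibbsLaw_eq]
  refine ⟨?_, ?_, ?_⟩
  · refine le_trans ?_ ((h₁ N).trans (ENNReal.ofReal_le_ofReal (Kexp_le_Kexp hK₁ hK12 hn)))
    refine le_of_eq ?_
    congr 1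
    ext z
    simp only [Set.mem_setOf_eq, empiricalDensityField_eq_sum]
    exact Iff.rfl
  · exact (h₂ N).trans (ENNReal.ofReal_le_ofReal (Kexp_le_Kexp hK₂ hK22 hn))
  · exact (h₃ N).trans (ENNReal.ofReal_le_ofReal (Kexp_le_Kexp hK₃ hK32 hn))

/-- The same statement as the item of route `TwoClocks` (`TwoClocks.UniformLocalGibbsConcentration`,
the shared item stmt-AtomisticToContinuum-14445; the two route decls are syntactically identical). -/
theorem twoClocks_uniformLocalGibbsConcentration_proof :
    Summit.AtomisticToContinuum.HydrodynamicLimit.Theses.TwoClocks.UniformLocalGibbsConcentration :=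
  uniformLocalGibbsConcentration_proof

end Summit.AtomisticToContinuum.HydrodynamicLimit.Theorems

end
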